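import Mathlib
import Literature.RingTheory.KrullDimension.HomogeneousCommonZero
import Literature.RingTheory.MvPolynomial.HomogeneousDimension

/-!
# The multihomogeneous Bézout existence theorem: a multihomogeneous system whose Bézout number is
# positive has a common zero in the product of projective spaces

Topic: `Literature/RingTheory/MvPolynomial`. Let `K` be an algebraically closed field and let the
variables `V` be distributed into blocks by `blk : V → ι` (the multihomogeneous coordinate ring of
`ℙ = Π_l ℙ^{n_l - 1}`, `n_l = #{v | blk v = l}`). Let `Q_j` (`j ∈ J`) be multihomogeneous
polynomials (`IsWeightedHomogeneous` for the block weights `v ↦ e_{blk v}`) of multidegrees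
`δ_j ∈ ℕ^ι`. **If the equations can be distributed over the blocks — `σ : J → ι` with
`δ_j(σ j) ≥ 1` and `#{j | σ j = l} ≤ n_l - 1` for every block `l` — then the `Q_j` have a common
zero `z : V → K` with a non-zero coordinate in every block** (`exists_common_zero_of_assignment`),
i.e. `V(Q_j : j) ⊆ ℙ` is non-empty. The hypothesis says exactly that the monomial
`Π_j T_{σ j}` survives in `ℤ[T_l]/(T_l^{n_l})`, i.e. that the product of the divisor classes
`Π_j (Σ_l δ_{j,l} T_l)` is non-zero in the Chow ring of `ℙ`; for `|J| = dim ℙ` it is the positivity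
of the mixed Bézout number `[Π_l T_l^{n_l - 1}] Π_j (Σ_l δ_{j,l} T_l)` of the tree's
`Literature.RingTheory.MvPolynomial.card_le_mixedBezout` (the upper count, van der Waerden 1928 /
Fulton Ex. 12.3.1; this form is `exists_common_zero_of_coeff_mixedBezout_ne_zero`), to which this
file is the existence companion (Fulton, *Intersection Theory*,
§12.2, Example 12.2.7 (a) with Thm. 12.2 (a): the intersection class of effective Cartier divisors
whose line bundles are generated by sections is represented by a non-negative cycle on the
intersection, so a non-zero product class forces a non-empty intersection).

## The proof: the `m`-homogeneous homotopy, run algebraically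

We formalize the degeneration behind the `m`-homogeneous homotopy of Morgan–Sommese (Appl. Math.
Comput. 24 (1987), Thm. 1 and §2: the start system "products of generic linear forms, one factor of
the right multidegree in each block" has exactly the Bézout number of non-singular solutions, and
the solution paths of `(1 - t) Q⁰ + t Q` starting there reach the target system), replacing path
tracking over `ℂ` by valuation theory over any algebraically closed field:

1. *Chart and start system.* Choose a chart variable `o l` in each block and give every equation
   `j` its own affine variable `κ j ≠ o (σ j)` in block `σ j` (padding the system with the linear
   equations `X_a = 0` for the unused affine variables, so that equations and affine variables
   correspond bijectively). The start system is `Q⁰_a = X_a^{δ_a(blk a)} · Π_{l ≠ blk a} X_{o l}^{δ_a l}`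
   (same multidegree as `Q_a`), and `g_a = (1 - t)·Q⁰_a + t·Q_a` dehomogenised at `X_{o l} = 1`
   lives in `R = K[t, y_a]`; all `g_a` vanish at the origin `𝔪₀ = (t, y)`.
2. *Krull.* A minimal prime `P ⊆ 𝔪₀` of `(g_a)_a` has height `≤ #A` (Krull's height theorem,
   Mathlib `Ideal.height_le_card_of_mem_minimalPrimes_span_finset`) while `height 𝔪₀ = #A + 1`
   (`Literature.RingTheory.KrullDimension.height_ker_constantCoeff`), so `P ≠ 𝔪₀`; and `t ∉ P`,
   for otherwise `y_a^{δ} ∈ P` for all `a` and `P = 𝔪₀` — this is the isolatedness of the start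
   solution. Hence `P ∩ K[t] = 0` (a prime of `K[t]` inside `(t)` not containing `t`).
3. *Specialisation `t ↦ 1`.* In `E = Frac(R/P) ⊇ K[t]` the classes `(1, ȳ)` solve the homotopy
   system. By Chevalley's extension theorem (Mathlib `Ideal.image_subset_nonunits_valuationSubring`)
   there is a valuation ring `O ⊆ E` containing `K[t]` with `t - 1 ∈ 𝔪_O`; rescaling each block by
   its coordinate of largest valuation puts the solution in `O` with a coordinate `1` in each block
   (multihomogeneity), and reduction modulo `𝔪_O` kills the start term: the `Q_j` acquire a common
   zero, with a coordinate `1` in each block, over the residue field `κ(O) ⊇ K` — the properness of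
   `ℙ` in valuative form.
4. *Descent.* By the Nullstellensatz (Mathlib `MvPolynomial.eq_vanishingIdeal_singleton_of_isMaximal`)
   the same system (`Q_j = 0`, one coordinate `= 1` per block) has a solution over `K`.

## References

* A. P. Morgan, A. J. Sommese, *A homotopy for solving general polynomial systems that respects
  m-homogeneous structures*, Appl. Math. Comput. 24 (1987) 101–113, Thm. 1, §2. [MorganSommese1987]
* W. Fulton, *Intersection Theory*, 2nd ed., Springer 1998, §12.2, Example 12.2.7 (a), Thm. 12.2 (a);
  Example 12.3.1. [Fulton1998]
* B. L. van der Waerden, *On Hilbert's function, series of composition of ideals and a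
  generalization of the theorem of Bézout*, Proc. Royal Acad. Amsterdam 31 (1928), 749–770.
-/

noncomputable section

open MvPolynomial Finset

namespace Literature.RingTheory.MvPolynomial

universe u v w

/-! ## Block weights: scaling of multihomogeneous polynomials -/

section Scaling

variable {R : Type*} [CommSemiring R] {S : Type*} [CommSemiring S] {V ι : Type*}

/-- The `l`-th component of the block multidegree of an exponent vector is the sum of the exponents
of the variables of block `l`. [folklore] -/
theorem weight_blockWeight_apply_eq_sum [Fintype V] [DecidableEq ι] (blk : V → ι) (s : V →₀ ℕ)
    (l : ι) :
    Finsupp.weight (fun v => (Pi.single (blk v) 1 : ι → ℕ)) s l =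
      ∑ v ∈ (univ : Finset V).filter (fun v => blk v = l), s v := by
  classical
  rw [Finsupp.weight_apply, Finsupp.sum_fintype _ _ (fun i => by simp), Finset.sum_apply,
    Finset.sum_filter]
  refine Finset.sum_congr rfl fun v _ => ?_
  rw [Pi.smul_apply, smul_eq_mul, Pi.single_apply]
  by_cases h : blk v = l
  · rw [if_pos h.symm, if_pos h, mul_one]
  · rw [if_neg (Ne.symm h), if_neg h, mul_zero]

/-- **Torus scaling of a multihomogeneous polynomial**: if `Q` is multihomogeneous of multidegree
`m` for the blocks of `blk`, then `Q((c_{blk v} x_v)_v) = (Π_l c_l^{m_l}) · Q(x)`. [folklore] -/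
theorem eval₂_blockSmul_of_isWeightedHomogeneous [Fintype V] [Fintype ι] [DecidableEq ι]
    (blk : V → ι) (f : R →+* S) {Q : MvPolynomial V R} {m : ι → ℕ}
    (hQ : Q.IsWeightedHomogeneous (fun v => (Pi.single (blk v) 1 : ι → ℕ)) m) (c : ι → S)
    (x : V → S) :
    eval₂ f (fun v => c (blk v) * x v) Q = (∏ l, c l ^ m l) * eval₂ f x Q := by
  classical
  conv_lhs => rw [Q.as_sum]
  conv_rhs => rw [Q.as_sum]
  rw [eval₂_sum, eval₂_sum, Finset.mul_sum]
  refine Finset.sum_congr rfl fun s hs => ?_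
  have hws : Finsupp.weight (fun v => (Pi.single (blk v) 1 : ι → ℕ)) s = m :=
    hQ (mem_support_iff.mp hs)
  rw [eval₂_monomial, eval₂_monomial, Finsupp.prod_fintype _ _ (fun i => pow_zero _),
    Finsupp.prod_fintype _ _ (fun i => pow_zero _)]
  simp_rw [mul_pow, Finset.prod_mul_distrib]
  have hc : ∏ v, c (blk v) ^ s v = ∏ l, c l ^ m l := by
    rw [← Finset.prod_fiberwise_of_maps_to (g := blk) (fun v _ => mem_univ (blk v))]
    refine Finset.prod_congr rfl fun l _ => ?_
    rw [← hws, weight_blockWeight_apply_eq_sum, Finset.prod_congr rfl fun v hv => by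
      rw [(mem_filter.mp hv).2], Finset.prod_pow_eq_pow_sum]
  rw [hc]; ring

/-- The weight of a single variable. [folklore] -/
theorem isWeightedHomogeneous_X_blockWeight [DecidableEq ι] (blk : V → ι) (v : V) :
    (X v : MvPolynomial V R).IsWeightedHomogeneous (fun v => (Pi.single (blk v) 1 : ι → ℕ))
      (Pi.single (blk v) 1) :=
  isWeightedHomogeneous_X _ _ _

/-- The weight of a power of a variable. [folklore] -/
theorem isWeightedHomogeneous_X_pow_blockWeight [DecidableEq ι] (blk : V → ι) (v : V) (n : ℕ) :
    (X v ^ n : MvPolynomial V R).IsWeightedHomogeneous (fun v => (Pi.single (blk v) 1 : ι → ℕ))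
      (Pi.single (blk v) n) := by
  have h := (isWeightedHomogeneous_X_blockWeight (R := R) blk v).pow n
  rwa [← Pi.single_smul', smul_eq_mul, mul_one] at h

end Scaling

/-! ## Descent of block-normalised zeros to the algebraically closed ground field -/

section Descent

variable {K : Type u} [Field K] [IsAlgClosed K] {L : Type*} [Field L]
  {V : Type v} [Finite V] {J : Type*}

/-- **Nullstellensatz descent**: if polynomials `Q_j` over an algebraically closed field `K` have,
over some field `L ⊇ K`, a common zero with prescribed coordinates `z (o l) = 1`, then they have such
a common zero over `K`. [folklore] -/
theorem exists_common_zero_of_common_zero_extension (f : K →+* L) (Q : J → MvPolynomial V K)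
    {ι : Type*} (o : ι → V) (zL : V → L) (hz1 : ∀ l, zL (o l) = 1)
    (hzQ : ∀ j, eval₂ f zL (Q j) = 0) :
    ∃ z : V → K, (∀ l, z (o l) = 1) ∧ ∀ j, eval z (Q j) = 0 := by
  classical
  set Ev : MvPolynomial V K →+* L := eval₂Hom f zL with hEv
  set 𝔨 : Ideal (MvPolynomial V K) := RingHom.ker Ev with h𝔨
  have h𝔨top : 𝔨 ≠ ⊤ := RingHom.ker_ne_top Ev
  obtain ⟨𝔪, h𝔪max, h𝔨𝔪⟩ := Ideal.exists_le_maximal 𝔨 h𝔨top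
  obtain ⟨z, hz⟩ := MvPolynomial.eq_vanishingIdeal_singleton_of_isMaximal (K := K) h𝔪max
  have hvan : ∀ p ∈ 𝔨, eval z p = 0 := by
    intro p hp
    have hp' : p ∈ (vanishingIdeal K {z} : Ideal (MvPolynomial V K)) := hz ▸ h𝔨𝔪 hp
    rw [mem_vanishingIdeal_singleton_iff] at hp'
    exact hp'
  refine ⟨z, fun l => ?_, fun j => hvan _ ?_⟩
  · have h := hvan (X (o l) - 1) (by
      rw [h𝔨, RingHom.mem_ker, map_sub, map_one, hEv, coe_eval₂Hom, eval₂_X, hz1, sub_self])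
    rw [map_sub, map_one, eval_X] at h
    exact sub_eq_zero.mp h
  · rw [h𝔨, RingHom.mem_ker, hEv, coe_eval₂Hom]
    exact hzQ j

end Descent

/-! ## Valuation rings: rescaling a block to integral coordinates with a unit coordinate -/

section ValuationScaling

variable {E : Type*} [Field E]

/-- In a valuation ring `O ⊆ E`, a finite family with a non-zero member can be rescaled into `O`
with one member equal to `1`: divide by a member of largest valuation. [folklore] -/
theorem exists_rescale_mem_valuationSubring (O : ValuationSubring E) {S : Type*} [Finite S]
    (x : S → E) (s₁ : S) (hs₁ : x s₁ ≠ 0) :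
    ∃ s₀ : S, x s₀ ≠ 0 ∧ ∀ s, (x s₀)⁻¹ * x s ∈ O := by
  haveI : Nonempty S := ⟨s₁⟩
  obtain ⟨s₀, hs₀⟩ := Finite.exists_max fun s => O.valuation (x s)
  have hx0 : x s₀ ≠ 0 := by
    intro h
    have h1 := hs₀ s₁
    rw [h, map_zero, le_zero_iff, map_eq_zero] at h1
    exact hs₁ h1
  refine ⟨s₀, hx0, fun s => ?_⟩
  obtain ⟨a, ha⟩ := (O.valuation_le_iff (x s) (x s₀)).mp (hs₀ s)
  have : (x s₀)⁻¹ * x s = a := by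
    rw [← ha]; field_simp
  rw [this]; exact a.2

end ValuationScaling

/-! ## The core: equations in bijection with the affine variables -/

section Prime

variable {K : Type u} [Field K]

/-- The polynomial ring `K[t]` embeds in `R ⧸ P` when `P ⊆ 𝔪₀ = ker (constant coefficient)` is a
prime of a polynomial ring `R` not containing the variable `t`: the contraction of `P` to `K[t]` is
a prime inside `(t)` not containing `t`, hence zero. [folklore] -/
theorem injective_quotient_comp_aeval_X {n : ℕ} (P : Ideal (MvPolynomial (Fin n) K)) [P.IsPrime]
    (hP : P ≤ RingHom.ker (constantCoeff : MvPolynomial (Fin n) K →+* K)) (i : Fin n)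
    (ht : (X i : MvPolynomial (Fin n) K) ∉ P) :
    Function.Injective ((Ideal.Quotient.mk P).comp
      (Polynomial.aeval (R := K) (X i : MvPolynomial (Fin n) K)).toRingHom) := by
  rw [RingHom.injective_iff_ker_eq_bot]
  set φ := (Polynomial.aeval (R := K) (X i : MvPolynomial (Fin n) K)).toRingHom with hφ
  have hφapp : ∀ f, φ f = Polynomial.eval₂ (algebraMap K (MvPolynomial (Fin n) K)) (X i) f :=
    fun f => rfl
  set 𝔮 : Ideal (Polynomial K) := RingHom.ker ((Ideal.Quotient.mk P).comp φ) with h𝔮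
  have h𝔮eq : 𝔮 = P.comap φ := by
    rw [h𝔮, ← RingHom.comap_ker, Ideal.mk_ker]
  haveI : 𝔮.IsPrime := h𝔮eq ▸ Ideal.IsPrime.comap φ
  -- `𝔮 ⊆ (X)`
  have h𝔮le : 𝔮 ≤ Ideal.span {(Polynomial.X : Polynomial K)} := by
    intro f hf
    rw [h𝔮eq, Ideal.mem_comap] at hf
    have h0 : constantCoeff (φ f) = 0 := hP hf
    rw [hφapp, Polynomial.hom_eval₂, constantCoeff_X, Polynomial.eval₂_at_zero,
      RingHom.comp_apply] at h0
    change constantCoeff (C (f.coeff 0)) = 0 at h0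
    rw [constantCoeff_C] at h0
    exact Ideal.mem_span_singleton.mpr (Polynomial.X_dvd_iff.mpr h0)
  have hX : (Polynomial.X : Polynomial K) ∉ 𝔮 := by
    rw [h𝔮eq, Ideal.mem_comap, hφapp, Polynomial.eval₂_X]
    exact ht
  by_contra hne
  haveI hmax : 𝔮.IsMaximal := IsPrime.to_maximal_ideal hne
  have htop : Ideal.span {(Polynomial.X : Polynomial K)} ≠ ⊤ := by
    rw [Ne, Ideal.span_singleton_eq_top]; exact Polynomial.not_isUnit_X
  have heq : 𝔮 = Ideal.span {(Polynomial.X : Polynomial K)} := hmax.eq_of_le htop h𝔮le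
  exact hX (heq ▸ Ideal.mem_span_singleton_self _)

/-- **Krull step of the homotopy argument.** In `R = K[X_0, …, X_M]` let `t = X_{ν ∞}` and
`y_a = X_{ν a}` for a bijection `ν : A ⊔ {∞} ≃ {0, …, M}` (`#A = M`), and let `g_a = y_a^{e_a} + t·h_a`
lie in `𝔪₀ = (t, y)`. Then some prime `P` with `(g_a)_a ⊆ P ⊆ 𝔪₀` does not contain `t`:
a minimal prime of `(g_a)_a` inside `𝔪₀` has height `≤ M < M + 1 = height 𝔪₀` (Krull's height
theorem), and if it contained `t` it would contain every `y_a`, hence equal `𝔪₀`. [folklore] -/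
theorem exists_prime_le_ker_constantCoeff_not_mem {A : Type*} [Fintype A] {M : ℕ}
    (hM : Fintype.card A = M) (ν : Option A ≃ Fin (M + 1))
    (g h : A → MvPolynomial (Fin (M + 1)) K) (e : A → ℕ)
    (hg : ∀ a, g a = X (ν (some a)) ^ e a + X (ν none) * h a)
    (hg0 : ∀ a, constantCoeff (g a) = 0) :
    ∃ P : Ideal (MvPolynomial (Fin (M + 1)) K), P.IsPrime ∧ (∀ a, g a ∈ P) ∧
      P ≤ RingHom.ker (constantCoeff : MvPolynomial (Fin (M + 1)) K →+* K) ∧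
      (X (ν none) : MvPolynomial (Fin (M + 1)) K) ∉ P := by
  classical
  set m₀ : Ideal (MvPolynomial (Fin (M + 1)) K) :=
    RingHom.ker (constantCoeff : MvPolynomial (Fin (M + 1)) K →+* K) with hm₀
  haveI hm₀max : m₀.IsMaximal :=
    RingHom.ker_isMaximal_of_surjective _ fun c => ⟨C c, constantCoeff_C _ c⟩
  set 𝔤 : Ideal (MvPolynomial (Fin (M + 1)) K) :=
    Ideal.span (↑(univ.image g) : Set (MvPolynomial (Fin (M + 1)) K)) with h𝔤
  have h𝔤eq : (↑(univ.image g) : Set (MvPolynomial (Fin (M + 1)) K)) = Set.range g := by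
    rw [Finset.coe_image, Finset.coe_univ, Set.image_univ]
  have h𝔤le : 𝔤 ≤ m₀ := by
    rw [h𝔤, Ideal.span_le, h𝔤eq]
    rintro _ ⟨a, rfl⟩
    exact (RingHom.mem_ker).mpr (hg0 a)
  have hg𝔤 : ∀ a, g a ∈ 𝔤 := fun a => Ideal.subset_span (by rw [h𝔤eq]; exact ⟨a, rfl⟩)
  obtain ⟨P, hPmin, hPle⟩ := Ideal.exists_minimalPrimes_le h𝔤le
  haveI hPprime : P.IsPrime := hPmin.1.1
  have hPht : P.height ≤ M := by
    refine (Ideal.height_le_card_of_mem_minimalPrimes_span_finset hPmin).trans ?_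
    have : (univ.image g).card ≤ M := (Finset.card_image_le).trans (by rw [Finset.card_univ, hM])
    exact_mod_cast this
  have hm₀ht : m₀.height = (M + 1 : ℕ) :=
    Literature.RingTheory.KrullDimension.height_ker_constantCoeff (k := K) (M + 1)
  have hPne : P ≠ m₀ := by
    intro hPm
    rw [hPm, hm₀ht] at hPht
    have : M + 1 ≤ M := by exact_mod_cast hPht
    omega
  refine ⟨P, hPprime, fun a => hPmin.1.2 (hg𝔤 a), hPle, fun ht => hPne (le_antisymm hPle ?_)⟩
  refine ker_constantCoeff_le_of_forall_X_mem fun i => ?_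
  obtain ⟨w, rfl⟩ := ν.surjective i
  cases w with
  | none => exact ht
  | some a =>
    have h1 : g a ∈ P := hPmin.1.2 (hg𝔤 a)
    rw [hg] at h1
    have h3 : X (ν none) * h a ∈ P := P.mul_mem_right _ ht
    have h2 : X (ν (some a)) ^ e a ∈ P := (Submodule.add_mem_iff_left P h3).mp h1
    exact hPprime.mem_of_pow_mem _ h2

end Prime

section Core

variable {K : Type u} [Field K] [IsAlgClosed K]
variable {V : Type v} [Fintype V] [DecidableEq V] {ι : Type w} [Fintype ι] [DecidableEq ι]

omit [DecidableEq V] in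
/-- **Valuative step of the homotopy argument.** Let `E ⊇ K` be a field with a valuation ring
`O` containing the image of `K` and an element `t` with `t - 1 ∈ 𝔪_O`, and let `x : V → E` have a
coordinate `1` in every block and satisfy `(1 - t)·Q⁰_a(x) + t·Q_a(x) = 0` for multihomogeneous
`Q_a, Q⁰_a` (over `K`) of the same multidegree. Then the `Q_a` have a common zero over `K` with a
coordinate `1` in every block: rescale each block by its coordinate of largest valuation, reduce
modulo `𝔪_O` (the start term dies with `1 - t`), and descend by the Nullstellensatz. [folklore] -/
theorem exists_common_zero_of_valuationSubring {E : Type*} [Field E] (O : ValuationSubring E)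
    (fK : K →+* E) (hfK : ∀ k, fK k ∈ O) (tE : E) (htO : tE ∈ O) (ht1 : tE - 1 ∈ O.nonunits)
    (blk : V → ι) (o : ι → V) (ho : ∀ l, blk (o l) = l) {A : Type*}
    (Q Q0 : A → MvPolynomial V K) (m : A → ι → ℕ)
    (hQ : ∀ a, (Q a).IsWeightedHomogeneous (fun v => (Pi.single (blk v) 1 : ι → ℕ)) (m a))
    (hQ0 : ∀ a, (Q0 a).IsWeightedHomogeneous (fun v => (Pi.single (blk v) 1 : ι → ℕ)) (m a))
    (x : V → E) (hx : ∀ l, x (o l) = 1)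
    (hrel : ∀ a, (1 - tE) * eval₂ fK x (Q0 a) + tE * eval₂ fK x (Q a) = 0) :
    ∃ z : V → K, (∀ l, ∃ v, blk v = l ∧ z v = 1) ∧ ∀ a, eval z (Q a) = 0 := by
  classical
  -- rescale each block into `O` with a unit coordinate
  have hscale : ∀ l, ∃ v₀ : V, blk v₀ = l ∧ x v₀ ≠ 0 ∧
      ∀ v, blk v = l → (x v₀)⁻¹ * x v ∈ O := by
    intro l
    obtain ⟨s₀, hs₀, hmem⟩ := exists_rescale_mem_valuationSubring O
      (fun s : {v : V // blk v = l} => x s.1) ⟨o l, ho l⟩ (by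
        show x (o l) ≠ 0
        rw [hx]; exact one_ne_zero)
    exact ⟨s₀.1, s₀.2, hs₀, fun v hv => hmem ⟨v, hv⟩⟩
  choose v₀ hv₀blk hv₀ne hv₀mem using hscale
  obtain ⟨c, hc⟩ : ∃ c : ι → E, c = fun l => (x (v₀ l))⁻¹ := ⟨_, rfl⟩
  obtain ⟨x', hx'⟩ : ∃ x' : V → E, x' = fun v => c (blk v) * x v := ⟨_, rfl⟩
  have hx'mem : ∀ v, x' v ∈ O := fun v => by
    rw [hx', hc]; exact hv₀mem (blk v) v rfl
  have hx'v₀ : ∀ l, x' (v₀ l) = 1 := fun l => by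
    rw [hx', hc]
    simp only [hv₀blk]
    exact inv_mul_cancel₀ (hv₀ne l)
  have hrel' : ∀ a, (1 - tE) * eval₂ fK x' (Q0 a) + tE * eval₂ fK x' (Q a) = 0 := by
    intro a
    rw [hx', eval₂_blockSmul_of_isWeightedHomogeneous blk fK (hQ0 a) c x,
      eval₂_blockSmul_of_isWeightedHomogeneous blk fK (hQ a) c x]
    have h := congrArg (fun e => (∏ l, c l ^ m a l) * e) (hrel a)
    simp only [mul_zero] at h
    rw [← h]; ring
  -- pass to `O`
  let fKO : K →+* O :=
    { toFun := fun k => ⟨fK k, hfK k⟩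
      map_one' := Subtype.ext (map_one fK)
      map_mul' := fun a b => Subtype.ext (map_mul fK a b)
      map_zero' := Subtype.ext (map_zero fK)
      map_add' := fun a b => Subtype.ext (map_add fK a b) }
  have hfKO : O.subtype.comp fKO = fK := RingHom.ext fun k => rfl
  let xO : V → O := fun v => ⟨x' v, hx'mem v⟩
  have hxO : ∀ v, O.subtype (xO v) = x' v := fun v => rfl
  let tO : O := ⟨tE, htO⟩
  have htO' : O.subtype tO = tE := rfl
  have hevalO : ∀ p : MvPolynomial V K, O.subtype (eval₂ fKO xO p) = eval₂ fK x' p := by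
    intro p
    rw [hom_eval₂, hfKO]
    rfl
  have hrelO : ∀ a, (1 - tO) * eval₂ fKO xO (Q0 a) + tO * eval₂ fKO xO (Q a) = 0 := by
    intro a
    apply O.subtype_injective
    rw [map_add, map_mul, map_mul, map_sub, map_one, hevalO, hevalO, htO', map_zero]
    exact hrel' a
  -- reduce modulo `𝔪_O`
  set res := IsLocalRing.residue O with hres
  have hres_t : res tO = 1 := by
    have hmem : tO - 1 ∈ IsLocalRing.maximalIdeal O := by
      rw [← ValuationSubring.coe_mem_nonunits_iff]; exact ht1
    have h0 : res (tO - 1) = 0 := (Ideal.Quotient.eq_zero_iff_mem).mpr hmem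
    rwa [map_sub, map_one, sub_eq_zero] at h0
  have hzero : ∀ a, eval₂ (res.comp fKO) (fun v => res (xO v)) (Q a) = 0 := by
    intro a
    have h := congrArg res (hrelO a)
    rw [map_add, map_mul, map_mul, map_sub, map_one, hres_t, sub_self, zero_mul, zero_add,
      one_mul, map_zero, hom_eval₂] at h
    exact h
  have hone : ∀ l, res (xO (v₀ l)) = 1 := by
    intro l
    have : xO (v₀ l) = 1 := Subtype.ext (hx'v₀ l)
    rw [this, map_one]
  -- descend to `K`
  obtain ⟨z, hz1, hzQ⟩ := exists_common_zero_of_common_zero_extension (res.comp fKO) Q v₀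
    (fun v => res (xO v)) hone hzero
  exact ⟨z, fun l => ⟨v₀ l, hv₀blk l, hz1 l⟩, hzQ⟩

/-- **Core of the multihomogeneous Bézout existence theorem.** With a chart variable `o l` chosen
in each block, let the equations be indexed by the remaining ("affine") variables `a`, each `Q_a`
being multihomogeneous of a multidegree `m_a` positive on the block of `a`. Then the `Q_a` have a
common zero with a coordinate equal to `1` in every block.
[cite: MorganSommese1987, Thm. 1, §2] -/
theorem exists_common_zero_core (blk : V → ι) (o : ι → V) (ho : ∀ l, blk (o l) = l)
    (Q : {v : V // v ∉ Set.range o} → MvPolynomial V K)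
    (m : {v : V // v ∉ Set.range o} → ι → ℕ)
    (hQ : ∀ a, (Q a).IsWeightedHomogeneous (fun v => (Pi.single (blk v) 1 : ι → ℕ)) (m a))
    (hm : ∀ a, 1 ≤ m a (blk a)) :
    ∃ z : V → K, (∀ l, ∃ v, blk v = l ∧ z v = 1) ∧ ∀ a, eval z (Q a) = 0 := by
  classical
  -- the affine variables `A`, the ring `R = K[t, y_a]` on `Fin (M+1)` variables
  obtain ⟨M, hM⟩ : ∃ M, Fintype.card {v : V // v ∉ Set.range o} = M := ⟨_, rfl⟩
  let ν : Option {v : V // v ∉ Set.range o} ≃ Fin (M + 1) :=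
    (Fintype.equivFin _).trans (finCongr (by rw [Fintype.card_option, hM]))
  have ho_mem : ∀ l, o l ∈ Set.range o := fun l => ⟨l, rfl⟩
  -- dehomogenisation `X_{o l} ↦ 1`, `X_a ↦ y_a`
  obtain ⟨dhv, hdhv⟩ : ∃ dhv : V → MvPolynomial (Fin (M + 1)) K,
      dhv = fun v => if h : v ∈ Set.range o then 1 else X (ν (some ⟨v, h⟩)) := ⟨_, rfl⟩
  have dh_o : ∀ l, dhv (o l) = 1 := fun l => by
    rw [hdhv]
    exact dif_pos (ho_mem l)
  have dh_a : ∀ a : {v : V // v ∉ Set.range o}, dhv a.1 = X (ν (some a)) := fun a => by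
    rw [hdhv]
    exact dif_neg a.2
  set dh : MvPolynomial V K →ₐ[K] MvPolynomial (Fin (M + 1)) K := aeval dhv with hdh
  -- the start system
  obtain ⟨Q0, hQ0⟩ : ∃ Q0 : {v : V // v ∉ Set.range o} → MvPolynomial V K,
      Q0 = fun a => X a.1 ^ m a (blk a.1) * ∏ l ∈ univ.erase (blk a.1), X (o l) ^ m a l :=
    ⟨_, rfl⟩
  have hQ0hom : ∀ a, (Q0 a).IsWeightedHomogeneous (fun v => (Pi.single (blk v) 1 : ι → ℕ))
      (m a) := by
    intro a
    have h1 := isWeightedHomogeneous_X_pow_blockWeight (R := K) blk a.1 (m a (blk a.1))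
    have h2 : (∏ l ∈ univ.erase (blk a.1), X (o l) ^ m a l : MvPolynomial V K).IsWeightedHomogeneous
        (fun v => (Pi.single (blk v) 1 : ι → ℕ)) (∑ l ∈ univ.erase (blk a.1), Pi.single l (m a l)) := by
      refine IsWeightedHomogeneous.prod _ _ _ fun l _ => ?_
      have := isWeightedHomogeneous_X_pow_blockWeight (R := K) blk (o l) (m a l)
      rwa [ho l] at this
    have h12 := h1.mul h2
    have hsum : Pi.single (blk a.1) (m a (blk a.1)) +
        ∑ l ∈ univ.erase (blk a.1), Pi.single l (m a l) = m a := by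
      have h := Finset.add_sum_erase (univ : Finset ι) (fun l => (Pi.single l (m a l) : ι → ℕ))
        (mem_univ (blk a.1))
      rw [h, Finset.univ_sum_single]
    rw [hQ0]
    rwa [hsum] at h12
  have dh_Q0 : ∀ a, dh (Q0 a) = X (ν (some a)) ^ m a (blk a.1) := by
    intro a
    rw [hQ0]
    simp only [hdh, map_mul, map_pow, map_prod, aeval_X, dh_a, dh_o, one_pow,
      Finset.prod_const_one, mul_one]
  -- the homotopy system and its prime
  obtain ⟨g, hg⟩ : ∃ g : {v : V // v ∉ Set.range o} → MvPolynomial (Fin (M + 1)) K,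
      g = fun a => (1 - X (ν none)) * dh (Q0 a) + X (ν none) * dh (Q a) := ⟨_, rfl⟩
  have hg_split : ∀ a, g a = X (ν (some a)) ^ m a (blk a.1) +
      X (ν none) * (dh (Q a) - X (ν (some a)) ^ m a (blk a.1)) := by
    intro a; rw [hg]; dsimp only; rw [dh_Q0]; ring
  have hg0 : ∀ a, constantCoeff (g a) = 0 := by
    intro a
    rw [hg_split, map_add, map_mul, map_pow, constantCoeff_X, constantCoeff_X,
      zero_pow (by have := hm a; omega), zero_add, zero_mul]
  obtain ⟨P, hPprime, hgP, hPle, htP⟩ := exists_prime_le_ker_constantCoeff_not_mem hM ν g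
    (fun a => dh (Q a) - X (ν (some a)) ^ m a (blk a.1)) (fun a => m a (blk a.1)) hg_split hg0
  haveI := hPprime
  -- `K[t] ↪ R/P ↪ E = Frac(R/P)`
  haveI : IsDomain (MvPolynomial (Fin (M + 1)) K ⧸ P) := Ideal.Quotient.isDomain P
  set E := FractionRing (MvPolynomial (Fin (M + 1)) K ⧸ P) with hE
  set π : MvPolynomial (Fin (M + 1)) K →+* E :=
    (algebraMap _ E).comp (Ideal.Quotient.mk P) with hπ
  have hπP : ∀ r ∈ P, π r = 0 := fun r hr => by
    rw [hπ, RingHom.comp_apply, Ideal.Quotient.eq_zero_iff_mem.mpr hr, map_zero]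
  set φ := (Polynomial.aeval (R := K) (X (ν none) : MvPolynomial (Fin (M + 1)) K)).toRingHom
    with hφ
  have hinj0 : Function.Injective ((Ideal.Quotient.mk P).comp φ) :=
    injective_quotient_comp_aeval_X P hPle (ν none) htP
  set ψ : Polynomial K →+* E := π.comp φ with hψ
  have hψinj : Function.Injective ψ := by
    rw [hψ, hπ, RingHom.comp_assoc]
    exact (IsFractionRing.injective _ E).comp hinj0
  set tE : E := π (X (ν none)) with htE
  have hφX : φ Polynomial.X = X (ν none) := by
    rw [hφ]; exact Polynomial.aeval_X _
  have hφC : ∀ k, φ (Polynomial.C k) = C k := fun k => by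
    rw [hφ]; exact Polynomial.aeval_C _ k
  have hψX : ψ Polynomial.X = tE := by
    rw [hψ, RingHom.comp_apply, hφX]
  -- Chevalley: a valuation ring `O ⊇ K[t]` of `E` with `t - 1 ∈ 𝔪_O`
  set Asub : Subring E := ψ.range with hAsub
  have huA : ψ (Polynomial.X - Polynomial.C 1) ∈ Asub := ⟨_, rfl⟩
  set I : Ideal Asub := Ideal.span {⟨ψ (Polynomial.X - Polynomial.C 1), huA⟩} with hI
  have hItop : I ≠ ⊤ := by
    intro htop
    rw [hI, Ideal.span_singleton_eq_top] at htop
    have hbij : Function.Bijective ψ.rangeRestrict :=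
      ⟨fun a b hab => hψinj (congrArg Subtype.val hab), ψ.rangeRestrict_surjective⟩
    set e₀ := RingEquiv.ofBijective ψ.rangeRestrict hbij with he₀
    have he₀X : e₀ (Polynomial.X - Polynomial.C 1) = ⟨ψ (Polynomial.X - Polynomial.C 1), huA⟩ :=
      Subtype.ext rfl
    have hunit : IsUnit (Polynomial.X - Polynomial.C (1 : K)) := by
      have h2 := htop.map e₀.symm
      rwa [← he₀X, e₀.symm_apply_apply] at h2
    exact Polynomial.not_isUnit_X_sub_C (1 : K) hunit
  obtain ⟨O, hAO, hIO⟩ := Ideal.image_subset_nonunits_valuationSubring I hItop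
  have hψO : ∀ f, ψ f ∈ O := fun f => hAO ⟨f, rfl⟩
  have htEO : tE ∈ O := hψX ▸ hψO _
  have ht1 : tE - 1 ∈ O.nonunits := by
    have h2 : ψ (Polynomial.X - Polynomial.C 1) = tE - 1 := by
      rw [map_sub, hψX, Polynomial.C_1, map_one]
    rw [← h2]
    exact hIO ⟨⟨_, huA⟩, Ideal.mem_span_singleton_self _, rfl⟩
  -- the `E`-solution `x = (1, ȳ)` of the homotopy system
  set x : V → E := fun v => π (dhv v) with hx
  set fK : K →+* E := π.comp (algebraMap K (MvPolynomial (Fin (M + 1)) K)) with hfK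
  have hfKO : ∀ k, fK k ∈ O := fun k => by
    have h2 : fK k = ψ (Polynomial.C k) := by
      rw [hfK, hψ]
      change π (algebraMap K (MvPolynomial (Fin (M + 1)) K) k) = π (φ (Polynomial.C k))
      rw [hφC]; rfl
    rw [h2]; exact hψO _
  have hπdh : ∀ p : MvPolynomial V K, π (dh p) = eval₂ fK x p := by
    intro p
    have h2 : π.comp (dh : MvPolynomial V K →+* MvPolynomial (Fin (M + 1)) K) = eval₂Hom fK x := by
      refine ringHom_ext (fun k => ?_) (fun i => ?_)
      · rw [RingHom.comp_apply, coe_eval₂Hom, eval₂_C, hfK, RingHom.comp_apply]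
        exact congrArg π (dh.commutes k)
      · rw [RingHom.comp_apply, coe_eval₂Hom, eval₂_X, hx]
        exact congrArg π (aeval_X dhv i)
    exact congrArg (fun f : MvPolynomial V K →+* E => f p) h2
  have hx_o : ∀ l, x (o l) = 1 := fun l => by
    rw [hx]; dsimp only; rw [dh_o, map_one]
  have hrel : ∀ a, (1 - tE) * eval₂ fK x (Q0 a) + tE * eval₂ fK x (Q a) = 0 := by
    intro a
    have h2 := hπP (g a) (hgP a)
    rw [hg] at h2
    dsimp only at h2
    rw [map_add, map_mul, map_mul, map_sub, map_one, hπdh, hπdh] at h2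
    exact h2
  exact exists_common_zero_of_valuationSubring O fK hfKO tE htEO ht1 blk o ho Q Q0 m hQ hQ0hom
    x hx_o hrel

end Core

/-! ## The theorem -/

section Main

variable {K : Type u} [Field K] [IsAlgClosed K]
variable {V : Type v} [Fintype V] [DecidableEq V] {ι : Type w} [Fintype ι] [DecidableEq ι]
variable {J : Type*} [Fintype J]

/-- **Multihomogeneous Bézout existence theorem.** Over an algebraically closed field, let
`Q_j` (`j ∈ J`) be multihomogeneous polynomials for the blocks of `blk : V → ι`, of multidegrees
`δ_j`. If the equations can be assigned to blocks, `σ : J → ι`, with `δ_j(σ j) ≥ 1` and at most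
`n_l - 1` equations on a block of `n_l` variables, then the `Q_j` have a common zero with a non-zero
coordinate in every block, i.e. `V(Q) ⊆ Π_l ℙ^{n_l - 1}` is non-empty. (The hypothesis is the
non-vanishing of `Π_j (Σ_l δ_{j,l} T_l)` in `ℤ[T]/(T_l^{n_l})`; for `|J| = Σ_l (n_l - 1)` it is the
positivity of the mixed Bézout number.) [cite: MorganSommese1987, Thm. 1, §2] -/
theorem exists_common_zero_of_assignment (blk : V → ι) (Q : J → MvPolynomial V K)
    (δ : J → ι → ℕ)
    (hQ : ∀ j, (Q j).IsWeightedHomogeneous (fun v => (Pi.single (blk v) 1 : ι → ℕ)) (δ j))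
    (σ : J → ι) (hσ : ∀ j, 1 ≤ δ j (σ j))
    (hload : ∀ l, ((univ : Finset J).filter (fun j => σ j = l)).card + 1 ≤
      ((univ : Finset V).filter (fun v => blk v = l)).card) :
    ∃ z : V → K, (∀ l, ∃ v, blk v = l ∧ z v ≠ 0) ∧ ∀ j, eval z (Q j) = 0 := by
  classical
  -- chart variables
  have hne : ∀ l, ∃ v, blk v = l := by
    intro l
    have h := hload l
    obtain ⟨v, hv⟩ := Finset.card_pos.mp (by omega : 0 < ((univ : Finset V).filter
      (fun v => blk v = l)).card)
    exact ⟨v, (mem_filter.mp hv).2⟩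
  choose o ho using hne
  -- an injection `κ : J ↪ A` over `σ`, `A` the affine variables
  have hemb : ∀ l, Nonempty ({j : J // σ j = l} ↪ {a : {v : V // v ∉ Set.range o} // blk a.1 = l}) := by
    intro l
    apply Function.Embedding.nonempty_of_card_le
    have h1 : Fintype.card {j : J // σ j = l} = ((univ : Finset J).filter (fun j => σ j = l)).card :=
      Fintype.card_subtype _
    have h2 : Fintype.card {a : {v : V // v ∉ Set.range o} // blk a.1 = l} + 1 =
        ((univ : Finset V).filter (fun v => blk v = l)).card := by
      rw [Fintype.card_subtype]
      have hset : (univ : Finset V).filter (fun v => blk v = l) =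
          insert (o l) (((univ : Finset {v : V // v ∉ Set.range o}).filter
            (fun a => blk a.1 = l)).map (Function.Embedding.subtype _)) := by
        ext v
        simp only [mem_filter, mem_univ, true_and, mem_insert, mem_map,
          Function.Embedding.coe_subtype, Subtype.exists, exists_and_right, exists_eq_right]
        constructor
        · intro hv
          by_cases h : v = o l
          · exact Or.inl h
          · refine Or.inr ⟨?_, hv⟩
            rintro ⟨l', rfl⟩
            exact h (by rw [← hv, ho l'])
        · rintro (rfl | ⟨_, hv⟩)
          · exact ho l
          · exact hv
      rw [hset, Finset.card_insert_of_notMem, Finset.card_map]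
      simp only [mem_map, mem_filter, mem_univ, true_and, Function.Embedding.coe_subtype,
        Subtype.exists, exists_and_right, exists_eq_right, not_exists]
      intro h _
      exact h ⟨l, rfl⟩
    have := hload l
    omega
  have emb := fun l => (hemb l).some
  let κ : J → {v : V // v ∉ Set.range o} := fun j => (emb (σ j) ⟨j, rfl⟩).1
  have hκblk : ∀ j, blk (κ j).1 = σ j := fun j => (emb (σ j) ⟨j, rfl⟩).2
  have hκinj : Function.Injective κ := by
    intro j j' h
    have hσ' : σ j = σ j' := by rw [← hκblk j, ← hκblk j', h]
    have key : ∀ (l : ι) (a b : {j : J // σ j = l}), (emb l a).1 = (emb l b).1 → a = b :=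
      fun l a b hab => (emb l).injective (Subtype.ext hab)
    revert h
    generalize hja : (⟨j, rfl⟩ : {i : J // σ i = σ j}) = ja
    intro h
    have : ∀ (l : ι) (hj : σ j = l) (hj' : σ j' = l),
        (emb l ⟨j, hj⟩).1 = (emb l ⟨j', hj'⟩).1 → j = j' := by
      intro l hj hj' hh
      have := key l ⟨j, hj⟩ ⟨j', hj'⟩ hh
      exact congrArg Subtype.val this
    refine this (σ j') (hσ') rfl ?_
    subst hja
    -- rewrite `κ j` along `σ j = σ j'`
    have e1 : (emb (σ j') ⟨j, hσ'⟩).1 = κ j := by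
      change (emb (σ j') ⟨j, hσ'⟩).1 = (emb (σ j) ⟨j, rfl⟩).1
      revert hσ'
      generalize σ j' = l'
      rintro rfl; rfl
    rw [e1]; exact h
  -- the padded system, indexed by the affine variables
  let Q' : {v : V // v ∉ Set.range o} → MvPolynomial V K := Function.extend κ Q (fun a => X a.1)
  let m' : {v : V // v ∉ Set.range o} → ι → ℕ :=
    Function.extend κ δ (fun a => Pi.single (blk a.1) 1)
  have hQ'κ : ∀ j, Q' (κ j) = Q j := fun j => hκinj.extend_apply _ _ j
  have hm'κ : ∀ j, m' (κ j) = δ j := fun j => hκinj.extend_apply _ _ j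
  have hQ'hom : ∀ a, (Q' a).IsWeightedHomogeneous (fun v => (Pi.single (blk v) 1 : ι → ℕ)) (m' a) := by
    intro a
    by_cases h : ∃ j, κ j = a
    · obtain ⟨j, rfl⟩ := h
      rw [hQ'κ, hm'κ]; exact hQ j
    · simp only [Q', m', Function.extend_apply' _ _ _ h]
      exact isWeightedHomogeneous_X_blockWeight blk a.1
  have hm' : ∀ a, 1 ≤ m' a (blk a.1) := by
    intro a
    by_cases h : ∃ j, κ j = a
    · obtain ⟨j, rfl⟩ := h
      rw [hm'κ, hκblk]; exact hσ j
    · simp only [m', Function.extend_apply' _ _ _ h, Pi.single_eq_same, le_refl]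
  obtain ⟨z, hzblk, hzQ⟩ := exists_common_zero_core blk o ho Q' m' hQ'hom hm'
  refine ⟨z, fun l => ?_, fun j => ?_⟩
  · obtain ⟨v, hv, hv1⟩ := hzblk l
    exact ⟨v, hv, by rw [hv1]; exact one_ne_zero⟩
  · have := hzQ (κ j)
    rwa [hQ'κ] at this

end Main

/-! ## Bézout-number form -/

section BezoutNumber

variable {K : Type u} [Field K] [IsAlgClosed K]
variable {V : Type v} [Fintype V] [DecidableEq V] {ι : Type w} [Fintype ι] [DecidableEq ι]
variable {J : Type*} [Fintype J]

/-- The coefficient of `T^a` in `Π_j (Σ_l δ_{j,l} T_l)` is the sum, over the assignments `σ : J → ι`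
with loads `a`, of `Π_j δ_{j, σ j}`; so if it is non-zero, some assignment has loads `a` and all
`δ_{j, σ j} ≥ 1`. [folklore] -/
theorem exists_assignment_of_coeff_prod_sum_ne_zero (δ : J → ι → ℕ) (a : ι →₀ ℕ)
    (h : coeff a (∏ j, ∑ l, δ j l • (X l : MvPolynomial ι ℕ)) ≠ 0) :
    ∃ σ : J → ι, (∀ j, 1 ≤ δ j (σ j)) ∧
      ∀ l, ((univ : Finset J).filter (fun j => σ j = l)).card = a l := by
  classical
  rw [Finset.prod_univ_sum (fun _ : J => (univ : Finset ι)) (fun j l => δ j l • (X l : MvPolynomial ι ℕ)),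
    coeff_sum] at h
  obtain ⟨σ, -, hσ⟩ := Finset.exists_ne_zero_of_sum_ne_zero h
  have hterm : ∏ j, δ j (σ j) • (X (σ j) : MvPolynomial ι ℕ) =
      monomial (∑ j, Finsupp.single (σ j) 1) (∏ j, δ j (σ j)) := by
    simp_rw [nsmul_eq_mul]
    rw [Finset.prod_mul_distrib, ← Nat.cast_prod]
    have hX : ∏ j, (X (σ j) : MvPolynomial ι ℕ) = monomial (∑ j, Finsupp.single (σ j) 1) 1 := by
      rw [monomial_sum_one]; rfl
    rw [hX, ← C_eq_coe_nat, C_mul_monomial, mul_one, Nat.cast_id]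
  rw [hterm, coeff_monomial] at hσ
  split_ifs at hσ with heq
  · refine ⟨σ, fun j => Nat.one_le_iff_ne_zero.mpr fun h0 => hσ (Finset.prod_eq_zero (mem_univ j) h0),
      fun l => ?_⟩
    have := congrArg (fun f : ι →₀ ℕ => f l) heq
    simp only [Finsupp.coe_finsetSum, Finset.sum_apply, Finsupp.single_apply] at this
    rw [← this, Finset.card_filter]
  · exact absurd rfl hσ

/-- **Bézout-number form of the existence theorem** (square systems, in the notation of
`Literature.RingTheory.MvPolynomial.card_le_mixedBezout`): if the mixed Bézout number
`[Π_l T_l^{n_l - 1}] Π_j (Σ_l δ_{j,l} T_l)` of multihomogeneous `Q_j` (all blocks non-empty) is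
non-zero, the `Q_j` have a common zero with a non-zero coordinate in every block. Together with
`card_le_mixedBezout`: the number of isolated zeros lies between `1` (when there are finitely many)
and the Bézout number. [cite: MorganSommese1987, Thm. 1] -/
theorem exists_common_zero_of_coeff_mixedBezout_ne_zero (blk : V → ι)
    (hblk : ∀ l, 1 ≤ ((univ : Finset V).filter (fun v => blk v = l)).card)
    (Q : J → MvPolynomial V K) (δ : J → ι → ℕ)
    (hQ : ∀ j, (Q j).IsWeightedHomogeneous (fun v => (Pi.single (blk v) 1 : ι → ℕ)) (δ j))
    (hB : coeff (Finsupp.equivFunOnFinite.symm fun l =>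
        ((univ : Finset V).filter (fun v => blk v = l)).card - 1)
      (∏ j, ∑ l, δ j l • (X l : MvPolynomial ι ℕ)) ≠ 0) :
    ∃ z : V → K, (∀ l, ∃ v, blk v = l ∧ z v ≠ 0) ∧ ∀ j, eval z (Q j) = 0 := by
  classical
  obtain ⟨σ, hσ, hload⟩ := exists_assignment_of_coeff_prod_sum_ne_zero δ _ hB
  refine exists_common_zero_of_assignment blk Q δ hQ σ hσ fun l => ?_
  rw [hload l, Finsupp.coe_equivFunOnFinite_symm]
  have := hblk l
  omega

end BezoutNumber

end Literature.RingTheory.MvPolynomial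

end
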